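import Summits.CriticalPhenomena.PercolationContinuityZ3.Theorems.Transplant.BoxProdZ2Defs
import Summits.CriticalPhenomena.PercolationContinuityZ3.Theorems.Transplant.StatementLattices
import Summits.CriticalPhenomena.PercolationContinuityZ3.Theorems.Transplant.StatementPolynomialGrowth
import Summits.CriticalPhenomena.PercolationContinuityZ3.Theorems.Transplant.StatementCubicLattices
import Literature.Barriers.CriticalPhenomena.SubexponentialGrowthZdProofs
import HarnessLib

/-!
# Typed closures: every own-critical-point target of the lane follows from a same-`p` witness AT ITS CRITICAL DENSITY

builds on p205010 (kernel theorem, internal audit signed; external expert review pending).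
Status sentence (coordinator 2026-08-20T04:30Z): "θ(p_c) = 0 on ℤ^d, all d ≥ 2 — kernel-verified (Lean 4/Mathlib,
standard axioms); internal adversarial audit SIGNED 2026-08-20 04:29Z; external expert review pending."

PROOF-ONLY file (lane `prim-bschramm-*`, seat `prim-bschramm-stmt`; `README.md` §TODAY'S LANDING PLAN (c) "conditional closures").  The
continuation principle (p4's `SameP.criticalProb_lt_of_lawful`, any graph with countably many vertices; lead's one-density form
`SameP.theta_criticalProbIOf_eq_zero_of_samePWitnessAt`, `Transplant/BoxProdZ2Defs.lean`) says: a lawful bounded-envelope history scheme AT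
`p = p_c(G, x)` forcing `x ↔ ∞` (`SameP.SamePWitnessAt G x (criticalProbIOf G x)`, to be supplied only when `θ_x(p_c) > 0`) gives `θ_x(p_c) = 0`.
Hence each `@[conjecture]` target of the lane's statement files closes MODULO the single witness at its own critical density — the form in which
the (I-Φ) re-typing of Kozma–Nitzan §4 (design `BLUEPRINT-I-PHI.md`, NOT a theorem) is to deliver it:
`fccOwnCriticalContinuity_of_samePWitnessAt`, `bcc…`, `stackedTriangular…`, `slabOwnCriticalContinuity_of_samePWitnessAt` (all `d`, all `k`),
`zdTimesFiniteOwnCriticalContinuity_of_samePWitnessAt`, `heisenbergCriticalContinuity_of_samePWitnessAt`, and the quasi-transitive master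
statement `conj4_of_samePWitnessAt : (witnesses at p_c on every connected locally finite quasi-transitive graph with p_c < 1) → BenjaminiSchramm1996_conj4`;
plus the `SameP.SamePWitness` (all percolative densities) forms.  No definitions, no new hypotheses on any target; nothing open is asserted.
[cite: KozmaNitzan2024, §1 p. 2 (approach 1)] [cite: BenjaminiSchramm1996, Conj. 4]
-/

noncomputable section

namespace Summit.CriticalPhenomena.PercolationContinuityZ3.Theorems.Transplant

open MeasureTheory Literature.Probability.Percolation Literature.Probability.LatticeModels
open Literature.Geometry.MetricEmbeddings (cayleyGraph)
open Literature.Barriers.CriticalPhenomena (IsQuasiTransitive countable_of_connected_of_locallyFinite)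

/-! ## Cubic lattices -/

/-- **fcc at its own critical point, modulo a same-`p` witness at `p_c(fcc)`.** [cite: KozmaNitzan2024, §1 p. 2 (approach 1)] -/
theorem fccOwnCriticalContinuity_of_samePWitnessAt
    (h : 0 < theta fccGraph fccOrigin (criticalProbIOf fccGraph fccOrigin) → SameP.SamePWitnessAt fccGraph fccOrigin (criticalProbIOf fccGraph fccOrigin)) :
    FccOwnCriticalContinuity :=
  SameP.theta_criticalProbIOf_eq_zero_of_samePWitnessAt fccGraph fccOrigin h

/-- fcc from the all-densities witness `SameP.SamePWitness`. [cite: KozmaNitzan2024, §1 p. 2 (approach 1)] -/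
theorem fccOwnCriticalContinuity_of_samePWitness (h : SameP.SamePWitness fccGraph fccOrigin) : FccOwnCriticalContinuity :=
  SameP.theta_criticalProb_eq_zero_of_samePWitness fccGraph fccOrigin h

/-- **bcc at its own critical point, modulo a same-`p` witness at `p_c(bcc)`.** [cite: KozmaNitzan2024, §1 p. 2 (approach 1)] -/
theorem bccOwnCriticalContinuity_of_samePWitnessAt
    (h : 0 < theta bccGraph bccOrigin (criticalProbIOf bccGraph bccOrigin) → SameP.SamePWitnessAt bccGraph bccOrigin (criticalProbIOf bccGraph bccOrigin)) :
    BccOwnCriticalContinuity :=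
  SameP.theta_criticalProbIOf_eq_zero_of_samePWitnessAt bccGraph bccOrigin h

/-- bcc from the all-densities witness. [cite: KozmaNitzan2024, §1 p. 2 (approach 1)] -/
theorem bccOwnCriticalContinuity_of_samePWitness (h : SameP.SamePWitness bccGraph bccOrigin) : BccOwnCriticalContinuity :=
  SameP.theta_criticalProb_eq_zero_of_samePWitness bccGraph bccOrigin h

/-! ## Stacked triangular lattice, slabs, `ℤ^d × F` -/

/-- **`𝕋 □ ℤ` at its own critical point, modulo a same-`p` witness at `p_c`.** [cite: KozmaNitzan2024, §1 p. 2 (approach 1)] -/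
theorem stackedTriangularOwnCriticalContinuity_of_samePWitnessAt
    (h : 0 < theta stackedTriangularGraph ((0 : Site 2), (0 : Site 1)) (criticalProbIOf stackedTriangularGraph ((0 : Site 2), (0 : Site 1))) →
      SameP.SamePWitnessAt stackedTriangularGraph ((0 : Site 2), (0 : Site 1)) (criticalProbIOf stackedTriangularGraph ((0 : Site 2), (0 : Site 1)))) :
    StackedTriangularOwnCriticalContinuity :=
  SameP.theta_criticalProbIOf_eq_zero_of_samePWitnessAt stackedTriangularGraph _ h

/-- **Slabs `S_k` of `ℤ^d` at their own critical points (all `d`, all `k > 0`), modulo same-`p` witnesses at `p_c(S_k)`** (for `d = 3` the target is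
already a theorem, `slabZ3OwnCriticalContinuity_holds`; the content is `d ≥ 4`). [cite: KozmaNitzan2024, §1 p. 2 (approach 1)] -/
theorem slabOwnCriticalContinuity_of_samePWitnessAt (d : ℕ) [NeZero d]
    (h : ∀ k : ℕ, 0 < k → 0 < theta (slabGraph d k) (slabOrigin d k) (criticalProbIOf (slabGraph d k) (slabOrigin d k)) →
      SameP.SamePWitnessAt (slabGraph d k) (slabOrigin d k) (criticalProbIOf (slabGraph d k) (slabOrigin d k))) :
    SlabOwnCriticalContinuity d :=
  fun k hk => SameP.theta_criticalProbIOf_eq_zero_of_samePWitnessAt (slabGraph d k) (slabOrigin d k) (h k hk)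

/-- **`ℤ^d × F` at its own critical point (every finite connected `F`, every root), modulo same-`p` witnesses at `p_c(ℤ^d □ F)`.**
[cite: KozmaNitzan2024, §1 p. 2 (approach 1)] -/
theorem zdTimesFiniteOwnCriticalContinuity_of_samePWitnessAt (d : ℕ)
    (h : ∀ (W : Type) [Fintype W] (F : SimpleGraph W), F.Connected → ∀ w : W,
      0 < theta (zdGraph d □ F) ((0 : Site d), w) (criticalProbIOf (zdGraph d □ F) ((0 : Site d), w)) →
        SameP.SamePWitnessAt (zdGraph d □ F) ((0 : Site d), w) (criticalProbIOf (zdGraph d □ F) ((0 : Site d), w))) :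
    ZdTimesFiniteOwnCriticalContinuity d := by
  intro W _ F hF w
  haveI : Countable W := Finite.to_countable
  exact SameP.theta_criticalProbIOf_eq_zero_of_samePWitnessAt (zdGraph d □ F) ((0 : Site d), w) (h W F hF w)

/-! ## The Heisenberg group -/

/-- **`H₃(ℤ)` at its own critical point, modulo a same-`p` witness at `p_c(H₃)`** (tree carrier `cayleyGraph` on `ℤ × ℤ × ℤ`; p3's carrier by
`heisenbergCriticalContinuity_iff`, `HeisenbergCarriers.lean`). [cite: KozmaNitzan2024, §1 p. 2 (approach 1)] -/
theorem heisenbergCriticalContinuity_of_samePWitnessAt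
    (h : 0 < theta cayleyGraph ((0, 0, 0) : ℤ × ℤ × ℤ) (criticalProbIOf cayleyGraph ((0, 0, 0) : ℤ × ℤ × ℤ)) →
      SameP.SamePWitnessAt cayleyGraph ((0, 0, 0) : ℤ × ℤ × ℤ) (criticalProbIOf cayleyGraph ((0, 0, 0) : ℤ × ℤ × ℤ))) :
    HeisenbergCriticalContinuity :=
  SameP.theta_criticalProbIOf_eq_zero_of_samePWitnessAt cayleyGraph _ h

/-- `H₃(ℤ)` from the all-densities witness. [cite: KozmaNitzan2024, §1 p. 2 (approach 1)] -/
theorem heisenbergCriticalContinuity_of_samePWitness (h : SameP.SamePWitness cayleyGraph ((0, 0, 0) : ℤ × ℤ × ℤ)) : HeisenbergCriticalContinuity :=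
  SameP.theta_criticalProb_eq_zero_of_samePWitness cayleyGraph _ h

/-! ## The master statement -/

/-- **Benjamini–Schramm's Conjecture 4 modulo same-`p` witnesses at criticality**: if every connected, locally finite, quasi-transitive graph with
`p_c(G, x) < 1` and `θ_x(p_c) > 0` carried a lawful bounded-envelope history scheme at `p_c` forcing `x ↔ ∞`, Conjecture 4 would follow (the vertex
set is countable by connectedness and local finiteness, `countable_of_connected_of_locallyFinite`).  The hypothesis is exactly what the lane's
re-typing programme is to produce class by class; nothing open is asserted. [cite: BenjaminiSchramm1996, Conj. 4] [cite: KozmaNitzan2024, §1 p. 2] -/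
theorem conj4_of_samePWitnessAt
    (h : ∀ {V : Type} (G : SimpleGraph V) [G.LocallyFinite], G.Connected → IsQuasiTransitive G → ∀ x : V, criticalProb G x < 1 →
      0 < theta G x (criticalProbIOf G x) → SameP.SamePWitnessAt G x (criticalProbIOf G x)) :
    BenjaminiSchramm1996_conj4 := by
  intro V G _ hc hq x hx
  haveI : Countable V := countable_of_connected_of_locallyFinite G hc x
  exact SameP.theta_criticalProbIOf_eq_zero_of_samePWitnessAt G x (h G hc hq x hx)

/-- The transitive (Mathlib-class) spelling, same reduction. [cite: BenjaminiSchramm1996, Conj. 4] -/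
theorem conj4_transitive_of_samePWitnessAt
    (h : ∀ {V : Type} (G : SimpleGraph V) [G.LocallyFinite], G.Connected → MulAction.IsPretransitive (G ≃g G) V → ∀ x : V,
      criticalProb G x < 1 → 0 < theta G x (criticalProbIOf G x) → SameP.SamePWitnessAt G x (criticalProbIOf G x)) :
    BenjaminiSchramm1996_conj4_transitive := by
  intro V G _ hc ht x hx
  haveI : Countable V := countable_of_connected_of_locallyFinite G hc x
  exact SameP.theta_criticalProbIOf_eq_zero_of_samePWitnessAt G x (h G hc ht x hx)

end Summit.CriticalPhenomena.PercolationContinuityZ3.Theorems.Transplant
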